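import Literature.Analysis.ODE.LyapunovBarbashinKrasovskii
import Literature.MathematicalPhysics.PowerSystems.LosslessMultimachineEnergy
import Literature.MathematicalPhysics.PowerSystems.PhaseCohesiveEquilibriumUniqueness
import HarnessLib

/-!
# The lossless classical multimachine model with infinite buses: an energy well inside an angle
# window lies in the region of attraction of the equilibrium — the energy-function stability-region
# estimate `ℛ = {x ∈ 𝒫 : V(x) < V_min}` (Vu–Turitsyn 2016 §IV) for `n` machines, proved a priori by
# Barbashin–Krasovskii, with Vu–Turitsyn's closed-form lower bound for `V_min`

Topic `Literature/MathematicalPhysics/PowerSystems`, namespace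
`Literature.MathematicalPhysics.PowerSystems.ClassicalModel` (the namespace of
`LosslessMultimachineEnergy.lean`, whose dissipation identity `energy_hasDerivAt_withInfiniteBuses`
is the one used here). Everything below is PROVED; the definitions are the printed objects. This file
makes PARAMETRIC in `n` (machines) and `m` (buses of constant angle) what
`SMIBEnergyRegionOfAttraction.lean` (`n = m = 1`) and `ChiangThreeMachineRegionOfAttraction.lean`
(`n = 2`, `m = 1`) prove for two printed instances.

SOURCES (read on the page this session). T. L. Vu, K. Turitsyn, *Lyapunov functions family approach
to transient stability assessment*, IEEE TPWRS 31 (2016) 1269–1277 [VuTuritsyn2016] (arXiv:1409.1889,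
`lit read` chunks p0005, p0007, p0008, p0015): §II eq. (1) «m_k δ̈_k + d_k δ̇_k + Σ_j B_kj V_k V_j
sin(δ_k − δ_j) − P_k = 0»; §III (energy) «E = Σ_k m_k δ̇_k²/2 − Σ_{kj} B_kj V_kV_j cos δ_kj − Σ_k P_k
δ_k … The dissipative nature of the damping term in (1) ensures that the energy constructed in this
way is always decreasing in time», and «the classical Energy function is just one element of the
large cone of all possible Lyapunov functions corresponding to K_{kj} = B_kj V_k V_j»; §IV: «we define
… V_min = min_{x ∈ ∂𝒫^out} V(x) … Given the value of V_min the invariant set of the Lyapunov function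
V(x) where the convergence to equilibrium is certified is given by ℛ = {x ∈ 𝒫 : V(x) < V_min} … the
set ℛ is invariant, and thus, is an estimate of the stability region», the polytope being
`𝒫 = {|δ_kj + δ*_kj| < π}`; §IV third construction «an analytical approximation of V_min that does
not require any optimizations», Appendix 9.3: on the face `δ_kj = ±π − δ*_kj` every other edge term
`I_uv = cos δ*_uv + δ*_uv sin δ*_uv − cos δ_uv − δ_uv sin δ*_uv ≥ 0 ∀ x ∈ 𝒫` and the tight edge
contributes `−K_kj(cos θ*_kj + θ*_kj sin δ*_kj)`, `θ*_kj = ±π − δ*_kj`; Appendix 9.2 (convergence, by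
LaSalle). P. W. Sauer, M. A. Pai, *Power System Dynamics and Stability* (1998) [SauerPai1998] §9.5
(infinite bus = machine of fixed angle, «δ_m is simply taken as zero»), §9.6.2 eqs. (9.35), (9.48)
(`n = m = 1`: `V_cr = −P_m(π − 2δˢ) + 2P_e^max cos δˢ`). N. Rouche, P. Habets, M. Laloy, *Stability
theory by Liapunov's direct method* (1977) [RoucheHabetsLaloy1977] Ch. II Thm 1.3 (Barbashin–Krasovskii),
through `Literature.Analysis.ODE.sublevel_subset_regionOfAttraction_of_noCompleteTrajectory`.
F. Dörfler, M. Chertkov, F. Bullo, PNAS 110 (2013), SI §3.1 Lemma 2 (3) [DorflerChertkovBullo2013]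
(uniqueness of the equilibrium, one-to-one flow map), through the pairing identity and sector bounds
of `PhaseCohesiveEquilibriumUniqueness.lean`.

WHAT IS PROVED (no numerical input anywhere):

* `LosslessSystem n m` — the printed data: inertias `M`, dampings `D`, net powers `P`, symmetric
  machine–machine couplings `C i j = E_iE_jB_ij`, machine–bus couplings `K i b`, bus angles `β b`;
  `flow`, `IsEquilibrium` (power balance), the phase-space vector field `field` on
  `(Fin n → ℝ) × (Fin n → ℝ) ∋ (θ, ω)`, the printed energy `energy` and its angle part `potential`.
* `hasDerivAt_energy_comp_line`, `fderiv_energy_field` — DISSIPATION `dV(x)·F(x) = −Σ_i D_i ω_i²`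
  (from `energy_hasDerivAt_withInfiniteBuses` along the affine line through `x` in direction `F x`).
* `isCompact_energyWell` — for an OPEN BOUNDED angle window `G` and a level `c` with `c < U` on the
  frontier of `G`, the energy well `W = {(θ, ω) : θ ∈ G, V ≤ c}` is compact.
* `eq_of_noDissipation` — hypothesis (iii) of Barbashin–Krasovskii: with all `D_i > 0`, a global
  solution in `W` with zero dissipation starts at `(θˢ, 0)`, PROVIDED `θˢ` is the only equilibrium
  angle vector `θ ∈ G` with `U(θ) ≤ c` (this uniqueness is a HYPOTHESIS of every theorem here; for the
  phase-cohesive polytope it is the printed uniqueness of the power-flow solution, a separate result).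
* `energyWell_subset_regionOfAttraction` — **the theorem, window form**: `M_i, D_i > 0`, `C`
  symmetric, `G` open and bounded, `c < U` on `∂G`, uniqueness in the well ⇒ from every state of `W`
  a global solution exists and EVERY global solution stays in `W` and tends to `(θˢ, 0)`.
  `energyWell_subset_regionOfAttraction_of_lt` — Vu–Turitsyn's form `ℛ = {x ∈ G : V(x) < V_min}`.
* `vtPolytope` — Vu–Turitsyn's polytope `𝒫 = {|θ_ij + θˢ_ij| < π on machine edges, |(θ_i − β_b) +
  (θˢ_i − β_b)| < π on bus edges}`; `potential_eq_edgeSum` (the energy written edge-wise with the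
  power balance at `θˢ`); `cos_add_mul_sin_le` (`I_uv ≥ 0` on `𝒫`); `vtGap d = 2 cos d − (π − 2|d|)
  sin |d|` and `lt_potential_of_mem_frontier_vtPolytope` — the CLOSED-FORM boundary bound
  `U ≥ U(θˢ) + w_e · vtGap(θˢ_e)` on the face of edge `e` (`= V_cr` of Sauer–Pai (9.48) for
  `n = m = 1`); `eq_of_isEquilibrium_of_mem_vtPolytope` — «δ* is the only stationary point inside 𝒫»
  for a network connected through its buses (pairing identity and strict sector bound of
  `PhaseCohesiveEquilibriumUniqueness.lean`, edge by edge); `vtWell_subset_regionOfAttraction` —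
  **the theorem, polytope form**: for every `c` below `U(θˢ) + w_e vtGap(θˢ_e)` for all edges `e`,
  the well `{θ ∈ 𝒫, V ≤ c}` is positively invariant and attracted to `(θˢ, 0)` (off-diagonal
  couplings `≥ 0`, network connected through its buses, `θˢ` strictly phase cohesive on edges, `𝒫`
  bounded); `isBounded_vtPolytope` — `𝒫(θˢ)` IS bounded on a network connected through its buses;
  `vtWell_subset_regionOfAttraction'` — the same theorem with every hypothesis on the data
  (`M, D > 0`, `C` symmetric off-diagonal `≥ 0`, `K ≥ 0`, connected through the buses, `θˢ` a
  strictly phase-cohesive equilibrium, `c` below the closed-form level).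

THREE COLUMNS. CERTIFIED: `W ⊆` region of attraction of `(θˢ, 0)` for the MODEL `M` = lossless
(zero transfer conductance) network-reduced classical swing model with `n` machines and `m` buses of
constant angle (infinite buses / fixed references), constant internal voltages, and the CLASS `C` =
states in the well `W`. Estimates are INNER (sufficient, not necessary). MODELLED: absent effects =
transfer conductances, flux decay / AVR, governor dynamics, load dynamics (cell MODEL-VALIDITY rows
MV-2/MV-2L). Nothing here says a grid is stable. NOT HERE: the model WITHOUT an infinite bus
(rotation orbit of equilibria: needs the momentum first integral — the structure-preserving files
treat it), transfer conductances (no energy function: Pai 1981 §4.7.1; the flow map is not monotone there).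
-/

noncomputable section

open Real Set Filter Metric Finset
open scoped Topology

namespace Literature.MathematicalPhysics.PowerSystems.ClassicalModel

/-! ### The printed objects -/

/-- Data of the LOSSLESS classical network-reduced model with `n` machines and `m` buses of constant
angle: inertias `M_i`, dampings `D_i`, net mechanical powers `P_i`, machine–machine couplings
`C i j = E_iE_jB_ij` (used symmetrically), machine–bus couplings `K i b = E_iV_bB_ib` and the bus
angles `β b` (an infinite bus is a machine of fixed angle, Sauer–Pai §9.5).
[cite: VuTuritsyn2016, §II eq. (1); SauerPai1998, §9.5 (infinite-bus remark after (9.20))] -/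
structure LosslessSystem (n m : ℕ) where
  /-- inertias `M_i` -/
  M : Fin n → ℝ
  /-- dampings `D_i` -/
  D : Fin n → ℝ
  /-- net powers `P_i` -/
  P : Fin n → ℝ
  /-- machine–machine couplings `C_ij = E_iE_jB_ij` -/
  C : Fin n → Fin n → ℝ
  /-- machine–bus couplings `K_ib` -/
  K : Fin n → Fin m → ℝ
  /-- bus angles `β_b` (constant) -/
  β : Fin m → ℝ

namespace LosslessSystem

variable {n m : ℕ} (S : LosslessSystem n m)

/-- Electrical power leaving machine `i` at angles `θ`:
`Σ_j C_ij sin(θ_i − θ_j) + Σ_b K_ib sin(θ_i − β_b)`. [cite: VuTuritsyn2016, §II eq. (1)] -/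
def flow (θ : Fin n → ℝ) (i : Fin n) : ℝ :=
  ∑ j, S.C i j * Real.sin (θ i - θ j) + ∑ b, S.K i b * Real.sin (θ i - S.β b)

/-- `θ` is an equilibrium angle vector: power balance `P_i = Σ_j C_ij sin(θ_i − θ_j) + Σ_b K_ib
sin(θ_i − β_b)` at every machine (the power-flow-like equations (2)).
[cite: VuTuritsyn2016, §II eq. (2)] -/
def IsEquilibrium (θ : Fin n → ℝ) : Prop := ∀ i, S.P i = S.flow θ i

/-- The swing equations as a vector field on the phase space `(θ, ω) ∈ (Fin n → ℝ) × (Fin n → ℝ)`: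
`θ̇_i = ω_i`, `ω̇_i = (P_i − D_i ω_i − Σ_j C_ij sin(θ_i − θ_j) − Σ_b K_ib sin(θ_i − β_b)) / M_i`.
[cite: VuTuritsyn2016, §II eq. (1)] -/
def field (x : (Fin n → ℝ) × (Fin n → ℝ)) : (Fin n → ℝ) × (Fin n → ℝ) :=
  (x.2, fun i => (S.P i - S.D i * x.2 i - S.flow x.1 i) / S.M i)

/-- Potential (angle) part of the energy:
`U(θ) = −Σ_i P_i θ_i − ½ Σ_i Σ_j C_ij cos(θ_i − θ_j) − Σ_i Σ_b K_ib cos(θ_i − β_b)`.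
[cite: VuTuritsyn2016, §III (energy function display)] -/
def potential (θ : Fin n → ℝ) : ℝ :=
  -∑ i, S.P i * θ i - 1 / 2 * ∑ i, ∑ j, S.C i j * Real.cos (θ i - θ j)
    - ∑ i, ∑ b, S.K i b * Real.cos (θ i - S.β b)

/-- Kinetic part of the energy `Σ_i ½ M_i ω_i²`. [cite: VuTuritsyn2016, §III (energy function display)] -/
def kinetic (ω : Fin n → ℝ) : ℝ := ∑ i, S.M i / 2 * ω i ^ 2

/-- The printed energy function in absolute angles (with the infinite-bus terms of Sauer–Pai §9.5):
`V(θ, ω) = Σ_i (½M_iω_i² − P_iθ_i) − ½Σ_iΣ_j C_ij cos(θ_i − θ_j) − Σ_iΣ_b K_ib cos(θ_i − β_b)`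
— literally the function of `energy_hasDerivAt_withInfiniteBuses`.
[cite: VuTuritsyn2016, §III (energy function display); SauerPai1998, §9.6.2 eq. (9.35)] -/
def energy (x : (Fin n → ℝ) × (Fin n → ℝ)) : ℝ :=
  (∑ i, (S.M i / 2 * x.2 i ^ 2 - S.P i * x.1 i))
    - 1 / 2 * ∑ i, ∑ j, S.C i j * Real.cos (x.1 i - x.1 j)
    - ∑ i, ∑ b, S.K i b * Real.cos (x.1 i - S.β b)

/-! ### Elementary identities -/

/-- `V = kinetic + potential`. [cite: VuTuritsyn2016, §III] -/
theorem energy_eq_kinetic_add_potential (x : (Fin n → ℝ) × (Fin n → ℝ)) :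
    S.energy x = S.kinetic x.2 + S.potential x.1 := by
  simp only [energy, kinetic, potential, Finset.sum_sub_distrib]
  ring

/-- The kinetic energy is non-negative when the inertias are. [folklore] -/
private theorem kinetic_nonneg (hM : ∀ i, 0 ≤ S.M i) (ω : Fin n → ℝ) : 0 ≤ S.kinetic ω :=
  Finset.sum_nonneg fun i _ => mul_nonneg (div_nonneg (hM i) (by norm_num)) (sq_nonneg _)

/-- `U(θ) ≤ V(θ, ω)` when the inertias are non-negative. [folklore] -/
private theorem potential_le_energy (hM : ∀ i, 0 ≤ S.M i) (x : (Fin n → ℝ) × (Fin n → ℝ)) :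
    S.potential x.1 ≤ S.energy x := by
  rw [energy_eq_kinetic_add_potential]
  linarith [S.kinetic_nonneg hM x.2]

/-- At zero speed the energy is the potential. [folklore] -/
private theorem energy_of_snd_eq_zero {x : (Fin n → ℝ) × (Fin n → ℝ)} (hx : x.2 = 0) :
    S.energy x = S.potential x.1 := by
  rw [energy_eq_kinetic_add_potential]
  simp [kinetic, hx]

/-- A single kinetic term is bounded by the kinetic energy: `½M_iω_i² ≤ Σ_j ½M_jω_j²`. [folklore] -/
private theorem half_M_mul_sq_le_kinetic (hM : ∀ i, 0 ≤ S.M i) (ω : Fin n → ℝ) (i : Fin n) :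
    S.M i / 2 * ω i ^ 2 ≤ S.kinetic ω := by
  unfold kinetic
  exact Finset.single_le_sum (f := fun j => S.M j / 2 * ω j ^ 2)
    (fun j _ => mul_nonneg (div_nonneg (hM j) (by norm_num)) (sq_nonneg _)) (Finset.mem_univ i)

/-- The field vanishes exactly at the states `(θ, 0)` with `θ` an equilibrium angle vector
(non-zero inertias). [cite: VuTuritsyn2016, §II eq. (2)] -/
theorem field_eq_zero_iff (hM : ∀ i, S.M i ≠ 0) (x : (Fin n → ℝ) × (Fin n → ℝ)) :
    S.field x = 0 ↔ S.IsEquilibrium x.1 ∧ x.2 = 0 := by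
  constructor
  · intro h
    have h1 : x.2 = 0 := congrArg Prod.fst h
    refine ⟨fun i => ?_, h1⟩
    have h2 := congrArg (fun y => y.2 i) h
    simp only [field, Prod.snd_zero, Pi.zero_apply, div_eq_zero_iff] at h2
    rcases h2 with h2 | h2
    · rw [h1] at h2
      simp only [Pi.zero_apply, mul_zero, sub_zero] at h2
      linarith
    · exact absurd h2 (hM i)
  · rintro ⟨he, h0⟩
    refine Prod.ext h0 (funext fun i => ?_)
    simp only [field]
    rw [h0, ← he i]
    simp

/-! ### Smoothness and the dissipation identity -/

/-- The field is continuously differentiable. [cite: VuTuritsyn2016, §II eq. (1)] -/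
theorem contDiff_field : ContDiff ℝ 1 S.field := by
  unfold field flow
  refine ContDiff.prodMk contDiff_snd (contDiff_pi' fun i => ?_)
  fun_prop

/-- The energy is continuously differentiable. [cite: VuTuritsyn2016, §III] -/
theorem contDiff_energy : ContDiff ℝ 1 S.energy := by
  unfold energy
  fun_prop

/-- The energy is continuous. [cite: VuTuritsyn2016, §III] -/
theorem continuous_energy : Continuous S.energy :=
  S.contDiff_energy.continuous

/-- The potential is continuous. [cite: VuTuritsyn2016, §III] -/
theorem continuous_potential : Continuous S.potential := by
  unfold potential
  fun_prop

/-- The energy is differentiable. [cite: VuTuritsyn2016, §III] -/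
theorem differentiable_energy : Differentiable ℝ S.energy :=
  S.contDiff_energy.differentiable one_ne_zero

/-- DISSIPATION along the affine line through `x` in the direction of the field: `t ↦ V(x + t F(x))`
has derivative `−Σ_i D_i ω_i²` at `t = 0`. This is `energy_hasDerivAt_withInfiniteBuses` applied to
the curves `θ_i(t) = θ_i + tω_i`, `ω_i(t) = ω_i + t ω̇_i`, which satisfy the swing equations at the
instant `t = 0`. [cite: VuTuritsyn2016, §III («always decreasing in time»)] -/
theorem hasDerivAt_energy_comp_line (hC : ∀ i j, S.C i j = S.C j i) (hM : ∀ i, S.M i ≠ 0)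
    (x : (Fin n → ℝ) × (Fin n → ℝ)) :
    HasDerivAt (fun t : ℝ => S.energy (x + t • S.field x)) (-(∑ i, S.D i * x.2 i ^ 2)) 0 := by
  set θ : Fin n → ℝ → ℝ := fun i s => x.1 i + s * x.2 i with hθdef
  set ω : Fin n → ℝ → ℝ := fun i s => x.2 i + s * (S.field x).2 i with hωdef
  have hθ : ∀ i, HasDerivAt (θ i) (ω i 0) 0 := by
    intro i
    have h : HasDerivAt (fun s : ℝ => x.1 i + s * x.2 i) (1 * x.2 i) 0 :=
      ((hasDerivAt_id (0 : ℝ)).mul_const (x.2 i)).const_add (x.1 i)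
    have h0 : ω i 0 = 1 * x.2 i := by simp [hωdef]
    rw [h0]
    exact h
  have hω : ∀ i, HasDerivAt (ω i) ((S.field x).2 i) 0 := by
    intro i
    have h : HasDerivAt (fun s : ℝ => x.2 i + s * (S.field x).2 i) (1 * (S.field x).2 i) 0 :=
      ((hasDerivAt_id (0 : ℝ)).mul_const ((S.field x).2 i)).const_add (x.2 i)
    rw [one_mul] at h
    exact h
  have heq : ∀ i, S.M i * (S.field x).2 i = S.P i - S.D i * ω i 0
      - ∑ j, S.C i j * Real.sin (θ i 0 - θ j 0) - ∑ b, S.K i b * Real.sin (θ i 0 - S.β b) := by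
    intro i
    have h1 : (S.field x).2 i = (S.P i - S.D i * x.2 i - S.flow x.1 i) / S.M i := rfl
    rw [h1, mul_div_cancel₀ _ (hM i)]
    simp [hθdef, hωdef, flow, sub_sub, add_assoc]
  have key := energy_hasDerivAt_withInfiniteBuses S.M S.D S.P S.C hC S.K S.β θ ω
    (fun i => (S.field x).2 i) 0 hθ hω heq
  have hfun : (fun t : ℝ => S.energy (x + t • S.field x)) = fun s =>
      (∑ i, (S.M i / 2 * ω i s ^ 2 - S.P i * θ i s))
        - 1 / 2 * ∑ i, ∑ j, S.C i j * Real.cos (θ i s - θ j s)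
        - ∑ i, ∑ b, S.K i b * Real.cos (θ i s - S.β b) := by
    funext s
    simp [energy, hθdef, hωdef, field, smul_eq_mul, mul_comm s]
  have hval : (-(∑ i, S.D i * x.2 i ^ 2)) = -(∑ i, S.D i * ω i 0 ^ 2) := by
    simp [hωdef]
  rw [hfun, hval]
  exact key

/-- DISSIPATION IDENTITY in Fréchet form: `dV(x)(F(x)) = −Σ_i D_i ω_i²` (`C` symmetric, `M_i ≠ 0`).
[cite: VuTuritsyn2016, §III («always decreasing in time»); Pai1981, §4.7.1 («V̇ ≤ 0»)] -/
theorem fderiv_energy_field (hC : ∀ i j, S.C i j = S.C j i) (hM : ∀ i, S.M i ≠ 0)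
    (x : (Fin n → ℝ) × (Fin n → ℝ)) :
    fderiv ℝ S.energy x (S.field x) = -(∑ i, S.D i * x.2 i ^ 2) := by
  have hl : HasDerivAt (fun t : ℝ => x + t • S.field x) (S.field x) 0 := by
    simpa using ((hasDerivAt_id (0 : ℝ)).smul_const (S.field x)).const_add x
  have hE : HasFDerivAt S.energy (fderiv ℝ S.energy x) x := (S.differentiable_energy x).hasFDerivAt
  have h1 : HasDerivAt (fun t : ℝ => S.energy (x + t • S.field x))
      (fderiv ℝ S.energy x (S.field x)) 0 := by
    have h := hE.comp_hasDerivAt_of_eq (0 : ℝ) hl (by simp)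
    simpa [Function.comp_def] using h
  exact h1.unique (S.hasDerivAt_energy_comp_line hC hM x)

/-! ### The energy well over an angle window is compact -/

/-- If `c < U` on the frontier of an OPEN window `G`, the well `{θ ∈ G, V ≤ c}` equals
`{θ ∈ closure G, V ≤ c}` (it does not reach `∂G`), hence is closed. [cite: VuTuritsyn2016, §IV («the system trajectory cannot meet the boundary segments … of the set ℛ»)] -/
theorem energyWell_eq_closure (hM : ∀ i, 0 ≤ S.M i) {G : Set (Fin n → ℝ)} (hGo : IsOpen G) {c : ℝ}
    (hfr : ∀ θ ∈ frontier G, c < S.potential θ) :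
    {x : (Fin n → ℝ) × (Fin n → ℝ) | x.1 ∈ G ∧ S.energy x ≤ c}
      = {x | x.1 ∈ closure G ∧ S.energy x ≤ c} := by
  ext x
  constructor
  · rintro ⟨h1, h2⟩
    exact ⟨subset_closure h1, h2⟩
  · rintro ⟨h1, h2⟩
    refine ⟨?_, h2⟩
    by_contra hx
    have hmem : x.1 ∈ frontier G := by
      rw [frontier, hGo.interior_eq]
      exact ⟨h1, hx⟩
    have := hfr x.1 hmem
    linarith [S.potential_le_energy hM x]

/-- COMPACTNESS OF THE WELL: `M_i > 0`, `G` open and bounded, `c < U` on `∂G` ⇒ the energy well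
`W = {(θ, ω) : θ ∈ G, V(θ, ω) ≤ c}` is compact (angles in `closure G`, each speed bounded by
`√(2(c − min U)/M_i)`). [cite: VuTuritsyn2016, §IV (set ℛ)] -/
theorem isCompact_energyWell (hM : ∀ i, 0 < S.M i) {G : Set (Fin n → ℝ)} (hGo : IsOpen G)
    (hGb : Bornology.IsBounded G) {c : ℝ} (hfr : ∀ θ ∈ frontier G, c < S.potential θ) :
    IsCompact {x : (Fin n → ℝ) × (Fin n → ℝ) | x.1 ∈ G ∧ S.energy x ≤ c} := by
  have hM' : ∀ i, 0 ≤ S.M i := fun i => (hM i).le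
  rw [S.energyWell_eq_closure hM' hGo hfr]
  have hGc : IsCompact (closure G) := hGb.isCompact_closure
  -- the potential is bounded below on `closure G`
  obtain ⟨U₀, hU₀⟩ : ∃ U₀ : ℝ, ∀ θ ∈ closure G, U₀ ≤ S.potential θ := by
    rcases (closure G).eq_empty_or_nonempty with h | h
    · exact ⟨0, by simp [h]⟩
    · obtain ⟨θ₀, _, hmin⟩ := hGc.exists_isMinOn h S.continuous_potential.continuousOn
      exact ⟨S.potential θ₀, fun θ hθ => hmin hθ⟩
  set R : Fin n → ℝ := fun i => Real.sqrt (2 * (c - U₀) / S.M i) with hRdef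
  have hsub : {x : (Fin n → ℝ) × (Fin n → ℝ) | x.1 ∈ closure G ∧ S.energy x ≤ c}
      ⊆ closure G ×ˢ Set.pi Set.univ (fun i => Icc (-R i) (R i)) := by
    rintro x ⟨h1, h2⟩
    refine ⟨h1, fun i _ => ?_⟩
    have hkin : S.M i / 2 * x.2 i ^ 2 ≤ c - U₀ := by
      have h3 := S.half_M_mul_sq_le_kinetic hM' x.2 i
      have h4 := S.energy_eq_kinetic_add_potential x
      have h5 := hU₀ x.1 h1
      linarith
    have hsq : x.2 i ^ 2 ≤ 2 * (c - U₀) / S.M i := by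
      rw [le_div_iff₀ (hM i)]
      nlinarith [hM i]
    have habs : |x.2 i| ≤ R i := Real.abs_le_sqrt hsq
    exact ⟨by linarith [neg_abs_le (x.2 i)], by linarith [le_abs_self (x.2 i)]⟩
  have hK : IsCompact (closure G ×ˢ Set.pi Set.univ (fun i => Icc (-R i) (R i))) :=
    hGc.prod (isCompact_univ_pi fun i => isCompact_Icc)
  refine hK.of_isClosed_subset ?_ hsub
  exact (isClosed_closure.preimage continuous_fst).inter
    (isClosed_le S.continuous_energy continuous_const)

/-! ### Hypothesis (iii): no complete trajectory with zero dissipation other than the equilibrium -/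

/-- **Hypothesis (iii) of Barbashin–Krasovskii for the lossless model.** With every `D_i > 0` and
`M_i ≠ 0`: a global solution `Y` with `Y(0)` in the well (`θ(0) ∈ G`, `V(Y 0) ≤ c`) along which the
dissipation `Σ D_i ω_i²` vanishes identically has `ω ≡ 0`, hence `ω̇(0) = 0` (uniqueness of the
derivative within `[0, 1]`), hence `θ(0)` is an equilibrium with `U(θ(0)) = V(Y 0) ≤ c`; if `θˢ` is
the only such equilibrium, `Y 0 = (θˢ, 0)`. [cite: VuTuritsyn2016, Appendix 9.2 («in the set {x : V̇(x) = 0} … the system converges to some stationary points»)] -/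
theorem eq_of_noDissipation (hM : ∀ i, S.M i ≠ 0) (hD : ∀ i, 0 < S.D i)
    {G : Set (Fin n → ℝ)} {c : ℝ} {θs : Fin n → ℝ}
    (huniq : ∀ θ ∈ G, S.IsEquilibrium θ → S.potential θ ≤ c → θ = θs)
    {Y : ℝ → (Fin n → ℝ) × (Fin n → ℝ)} (hY0 : (Y 0).1 ∈ G) (hYc : S.energy (Y 0) ≤ c)
    (hY : ∀ T : ℝ, ∀ t ∈ Icc 0 T, HasDerivWithinAt Y (S.field (Y t)) (Icc 0 T) t)
    (hzero : ∀ t, 0 ≤ t → -(∑ i, S.D i * (Y t).2 i ^ 2) = 0) :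
    Y 0 = (θs, 0) := by
  -- `ω ≡ 0` on `[0, ∞)`
  have hω : ∀ t, 0 ≤ t → (Y t).2 = 0 := by
    intro t ht
    have h := hzero t ht
    rw [neg_eq_zero, Finset.sum_eq_zero_iff_of_nonneg (fun i _ =>
      mul_nonneg (hD i).le (sq_nonneg _))] at h
    funext i
    have hi := h i (Finset.mem_univ i)
    rcases mul_eq_zero.1 hi with hi | hi
    · exact absurd hi (hD i).ne'
    · simpa using hi
  -- the speed vector has derivative `(field (Y 0)).2` and derivative `0` within `[0, 1]` at `0`
  have hd1 : HasDerivWithinAt (fun t => (Y t).2) ((S.field (Y 0)).2) (Icc 0 1) 0 := by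
    have h := ((hY 1 0 ⟨le_rfl, zero_le_one⟩).hasFDerivWithinAt.snd).hasDerivWithinAt
    simpa using h
  have hd0 : HasDerivWithinAt (fun t => (Y t).2) 0 (Icc 0 1) 0 :=
    (hasDerivWithinAt_const (0 : ℝ) (Icc (0 : ℝ) 1) (0 : Fin n → ℝ)).congr
      (fun t ht => hω t ht.1) (hω 0 le_rfl)
  have hu : UniqueDiffWithinAt ℝ (Icc (0 : ℝ) 1) 0 :=
    uniqueDiffOn_Icc zero_lt_one 0 ⟨le_rfl, zero_le_one⟩
  have hacc : (S.field (Y 0)).2 = 0 := hu.eq_deriv _ hd1 hd0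
  have hfield : S.field (Y 0) = 0 := by
    refine Prod.ext ?_ hacc
    show (Y 0).2 = 0
    exact hω 0 le_rfl
  obtain ⟨heq, hω0⟩ := (S.field_eq_zero_iff hM (Y 0)).1 hfield
  have hpot : S.potential (Y 0).1 ≤ c := by
    rw [← S.energy_of_snd_eq_zero hω0]
    exact hYc
  have hθ : (Y 0).1 = θs := huniq _ hY0 heq hpot
  exact Prod.ext hθ hω0

/-! ### The theorem (window form) -/

/-- **Energy well ⊆ region of attraction, window form** (the set `ℛ` of Vu–Turitsyn §IV for the
energy function over an arbitrary angle window, by Barbashin–Krasovskii in place of LaSalle).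
Let `M_i > 0`, `D_i > 0`, `C` symmetric; let `G` be an OPEN BOUNDED set of angle vectors and `c` a
level with `c < U(θ)` for every `θ` on the frontier of `G`; and suppose `θˢ` is the only
equilibrium angle vector `θ ∈ G` with `U(θ) ≤ c`. Then for every state `y = (θ, ω)` with `θ ∈ G` and
`V(y) ≤ c`: a global solution of the swing equations from `y` exists, and EVERY global solution `X`
from `y` satisfies `X(t).θ ∈ G`, `V(X t) ≤ c` for all `t ≥ 0` (positive invariance of the well) and
`X(t) → (θˢ, 0)`. CERTIFIED for the MODEL (lossless classical, `m` buses of constant angle) and the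
CLASS = the well; inner estimate. [cite: VuTuritsyn2016, §IV (invariant set ℛ) and Appendix 9.2; RoucheHabetsLaloy1977, Ch. II Thm 1.3] -/
theorem energyWell_subset_regionOfAttraction (hM : ∀ i, 0 < S.M i) (hD : ∀ i, 0 < S.D i)
    (hC : ∀ i j, S.C i j = S.C j i) {G : Set (Fin n → ℝ)} (hGo : IsOpen G)
    (hGb : Bornology.IsBounded G) {c : ℝ} (hfr : ∀ θ ∈ frontier G, c < S.potential θ)
    {θs : Fin n → ℝ} (huniq : ∀ θ ∈ G, S.IsEquilibrium θ → S.potential θ ≤ c → θ = θs)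
    {y : (Fin n → ℝ) × (Fin n → ℝ)} (hy : y.1 ∈ G) (hyc : S.energy y ≤ c) :
    (∃ X : ℝ → (Fin n → ℝ) × (Fin n → ℝ), X 0 = y ∧
        ∀ T : ℝ, ∀ t ∈ Icc 0 T, HasDerivWithinAt X (S.field (X t)) (Icc 0 T) t) ∧
      ∀ X : ℝ → (Fin n → ℝ) × (Fin n → ℝ), X 0 = y →
        (∀ T : ℝ, ∀ t ∈ Icc 0 T, HasDerivWithinAt X (S.field (X t)) (Icc 0 T) t) →
        (∀ t, 0 ≤ t → (X t).1 ∈ G ∧ S.energy (X t) ≤ c) ∧ Tendsto X atTop (𝓝 (θs, 0)) := by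
  have hM0 : ∀ i, S.M i ≠ 0 := fun i => (hM i).ne'
  set Gx : Set ((Fin n → ℝ) × (Fin n → ℝ)) := {x | x.1 ∈ G} with hGxdef
  have hGxo : IsOpen Gx := hGo.preimage continuous_fst
  set V' : (Fin n → ℝ) × (Fin n → ℝ) → ((Fin n → ℝ) × (Fin n → ℝ) →L[ℝ] ℝ) :=
    fun x => fderiv ℝ S.energy x with hV'def
  have hV : ∀ x ∈ Gx ∩ univ, HasFDerivAt S.energy (V' x) x := fun x _ =>
    (S.differentiable_energy x).hasFDerivAt
  have hVF' : ∀ x, V' x (S.field x) = -(∑ i, S.D i * x.2 i ^ 2) := fun x =>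
    S.fderiv_energy_field hC hM0 x
  have hVF : ∀ x ∈ Gx ∩ univ, V' x (S.field x) ≤ 0 := fun x _ => by
    rw [hVF' x, neg_nonpos]
    exact Finset.sum_nonneg fun i _ => mul_nonneg (hD i).le (sq_nonneg _)
  have hSeq : {x | x ∈ Gx ∩ univ ∧ S.energy x ≤ c} =
      {x : (Fin n → ℝ) × (Fin n → ℝ) | x.1 ∈ G ∧ S.energy x ≤ c} := by
    ext x
    simp [hGxdef]
  have hS : IsCompact {x | x ∈ Gx ∩ univ ∧ S.energy x ≤ c} := by
    rw [hSeq]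
    exact S.isCompact_energyWell hM hGo hGb hfr
  have hMhyp : ∀ Y : ℝ → (Fin n → ℝ) × (Fin n → ℝ), (Y 0 ∈ Gx ∩ univ ∧ S.energy (Y 0) ≤ c) →
      (∀ T : ℝ, ∀ t ∈ Icc 0 T, HasDerivWithinAt Y (S.field (Y t)) (Icc 0 T) t) →
      (∀ t, 0 ≤ t → V' (Y t) (S.field (Y t)) = 0) → Y 0 = (θs, 0) := by
    intro Y hY0 hY hzero
    have h1 : (Y 0).1 ∈ G := by
      have : Y 0 ∈ Gx := hY0.1.1
      simpa [hGxdef] using this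
    refine S.eq_of_noDissipation hM0 hD huniq h1 hY0.2 hY fun t ht => ?_
    rw [← hVF' (Y t)]
    exact hzero t ht
  have hMinv : ∀ z, z ∈ Gx ∩ univ ∧ S.energy z ≤ c → ∀ s : ℝ,
      ∀ X : ℝ → (Fin n → ℝ) × (Fin n → ℝ), X 0 = z →
      (∀ t ∈ Icc 0 s, HasDerivWithinAt X (S.field (X t)) (Icc 0 s) t) →
      ∀ t ∈ Icc 0 s, X t ∈ (univ : Set ((Fin n → ℝ) × (Fin n → ℝ))) :=
    fun _ _ _ _ _ _ _ _ => mem_univ _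
  have key := Literature.Analysis.ODE.sublevel_subset_regionOfAttraction_of_noCompleteTrajectory
    (E := (Fin n → ℝ) × (Fin n → ℝ)) (x₀ := (θs, 0)) hGxo hV hVF hS (S.contDiff_field) hMhyp hMinv
    (y := y) ⟨⟨hy, mem_univ _⟩, hyc⟩
  refine ⟨key.1, fun X hX0 hX => ?_⟩
  obtain ⟨hstay, htend⟩ := key.2 X hX0 hX
  refine ⟨fun t ht => ?_, htend⟩
  have h := hstay t ht
  have h1 : (X t).1 ∈ G := by
    have : X t ∈ Gx := h.1.1
    simpa [hGxdef] using this
  exact ⟨h1, h.2⟩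

/-- **Vu–Turitsyn's form `ℛ = {x ∈ 𝒫 : V(x) < V_min}`**: with `V_min ≤ U` on the frontier of the
window `G` and `θˢ` the only equilibrium angle vector `θ ∈ G` with `U(θ) < V_min`, every state `y`
with `θ ∈ G`, `V(y) < V_min` has a global solution, and every global solution from `y` stays in
`{θ ∈ G, V ≤ V(y)} ⊆ ℛ` and tends to `(θˢ, 0)` — «the set ℛ is invariant, and thus, is an estimate of
the stability region». [cite: VuTuritsyn2016, §IV eq. for ℛ and Appendix 9.2] -/
theorem energyWell_subset_regionOfAttraction_of_lt (hM : ∀ i, 0 < S.M i) (hD : ∀ i, 0 < S.D i)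
    (hC : ∀ i j, S.C i j = S.C j i) {G : Set (Fin n → ℝ)} (hGo : IsOpen G)
    (hGb : Bornology.IsBounded G) {Vmin : ℝ} (hfr : ∀ θ ∈ frontier G, Vmin ≤ S.potential θ)
    {θs : Fin n → ℝ} (huniq : ∀ θ ∈ G, S.IsEquilibrium θ → S.potential θ < Vmin → θ = θs)
    {y : (Fin n → ℝ) × (Fin n → ℝ)} (hy : y.1 ∈ G) (hyc : S.energy y < Vmin) :
    (∃ X : ℝ → (Fin n → ℝ) × (Fin n → ℝ), X 0 = y ∧
        ∀ T : ℝ, ∀ t ∈ Icc 0 T, HasDerivWithinAt X (S.field (X t)) (Icc 0 T) t) ∧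
      ∀ X : ℝ → (Fin n → ℝ) × (Fin n → ℝ), X 0 = y →
        (∀ T : ℝ, ∀ t ∈ Icc 0 T, HasDerivWithinAt X (S.field (X t)) (Icc 0 T) t) →
        (∀ t, 0 ≤ t → (X t).1 ∈ G ∧ S.energy (X t) ≤ S.energy y) ∧
          Tendsto X atTop (𝓝 (θs, 0)) :=
  S.energyWell_subset_regionOfAttraction hM hD hC hGo hGb
    (fun θ hθ => lt_of_lt_of_le hyc (hfr θ hθ))
    (fun θ hθ he hle => huniq θ hθ he (lt_of_le_of_lt hle hyc)) hy le_rfl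

/-! ### Vu–Turitsyn's polytope and the closed-form lower bound for `V_min`

On the polytope `𝒫 = {|δ_kj + δ*_kj| < π}` every edge term of the energy, written with the power
balance at the equilibrium as `−K_kj(cos δ_kj + δ_kj sin δ*_kj)`, is minimal at the equilibrium value
(`I_uv ≥ 0`, Appendix 9.3), and on the face `δ_kj = ±π − δ*_kj` the tight edge has risen by at least
`K_kj (2 cos δ*_kj − (π − 2|δ*_kj|) sin |δ*_kj|)`. For one machine and one bus this is exactly
Sauer–Pai's `V_cr = −P_m(π − 2δˢ) + 2P_e^max cos δˢ` ((9.48) with `P_m = P_e^max sin δˢ`). -/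

/-- Vu–Turitsyn's polytope centred at the equilibrium `θˢ`: `|(θ_i − θ_j) + (θˢ_i − θˢ_j)| < π` for
every machine edge (`C_ij ≠ 0`) and `|(θ_i − β_b) + (θˢ_i − β_b)| < π` for every bus edge
(`K_ib ≠ 0`) — «the polytope 𝒫 defined by the set of inequalities |δ_kj + δ*_kj| < π».
[cite: VuTuritsyn2016, §IV (definition of 𝒫)] -/
def vtPolytope (θs : Fin n → ℝ) : Set (Fin n → ℝ) :=
  {θ | (∀ i j, S.C i j ≠ 0 → |(θ i - θ j) + (θs i - θs j)| < π) ∧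
    (∀ i b, S.K i b ≠ 0 → |(θ i - S.β b) + (θs i - S.β b)| < π)}

/-- Vu–Turitsyn's per-edge gap `2 cos d − (π − 2|d|) sin |d|`: the rise of the edge term
`−(cos δ + δ sin d)` from `δ = d` to the nearer face `δ = ±π − d` of the polytope. For `n = m = 1`
and coupling `P_e^max` it is `V_cr` of Sauer–Pai (9.48) (with `V(δˢ, 0) = 0`).
[cite: VuTuritsyn2016, Appendix 9.3 (analytical approximation of V_min); SauerPai1998, §9.6.2 eq. (9.48)] -/
def vtGap (d : ℝ) : ℝ := 2 * Real.cos d - (π - 2 * |d|) * Real.sin |d|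

/-- One machine-edge constraint set `{θ | C_ij ≠ 0 → |θ_ij + θˢ_ij| < π}` is open (private
plumbing). [folklore] -/
private theorem isOpen_edgeConstraint (θs : Fin n → ℝ) (i j : Fin n) :
    IsOpen {θ : Fin n → ℝ | S.C i j ≠ 0 → |(θ i - θ j) + (θs i - θs j)| < π} := by
  by_cases h : S.C i j = 0
  · have : {θ : Fin n → ℝ | S.C i j ≠ 0 → |(θ i - θ j) + (θs i - θs j)| < π} = Set.univ := by
      ext θ
      simp [h]
    rw [this]
    exact isOpen_univ
  · have : {θ : Fin n → ℝ | S.C i j ≠ 0 → |(θ i - θ j) + (θs i - θs j)| < π}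
        = {θ | |(θ i - θ j) + (θs i - θs j)| < π} := by
      ext θ
      simp [h]
    rw [this]
    exact isOpen_lt (by fun_prop) continuous_const

/-- One bus-edge constraint set `{θ | K_ib ≠ 0 → |(θ_i − β_b) + (θˢ_i − β_b)| < π}` is open
(private plumbing). [folklore] -/
private theorem isOpen_busConstraint (θs : Fin n → ℝ) (i : Fin n) (b : Fin m) :
    IsOpen {θ : Fin n → ℝ | S.K i b ≠ 0 → |(θ i - S.β b) + (θs i - S.β b)| < π} := by
  by_cases h : S.K i b = 0
  · have : {θ : Fin n → ℝ | S.K i b ≠ 0 → |(θ i - S.β b) + (θs i - S.β b)| < π} = Set.univ := by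
      ext θ
      simp [h]
    rw [this]
    exact isOpen_univ
  · have : {θ : Fin n → ℝ | S.K i b ≠ 0 → |(θ i - S.β b) + (θs i - S.β b)| < π}
        = {θ | |(θ i - S.β b) + (θs i - S.β b)| < π} := by
      ext θ
      simp [h]
    rw [this]
    exact isOpen_lt (by fun_prop) continuous_const

/-- One machine-edge closed constraint set `{θ | C_ij ≠ 0 → |θ_ij + θˢ_ij| ≤ π}` is closed
(private plumbing). [folklore] -/
private theorem isClosed_edgeConstraint (θs : Fin n → ℝ) (i j : Fin n) :
    IsClosed {θ : Fin n → ℝ | S.C i j ≠ 0 → |(θ i - θ j) + (θs i - θs j)| ≤ π} := by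
  by_cases h : S.C i j = 0
  · have : {θ : Fin n → ℝ | S.C i j ≠ 0 → |(θ i - θ j) + (θs i - θs j)| ≤ π} = Set.univ := by
      ext θ
      simp [h]
    rw [this]
    exact isClosed_univ
  · have : {θ : Fin n → ℝ | S.C i j ≠ 0 → |(θ i - θ j) + (θs i - θs j)| ≤ π}
        = {θ | |(θ i - θ j) + (θs i - θs j)| ≤ π} := by
      ext θ
      simp [h]
    rw [this]
    exact isClosed_le (by fun_prop) continuous_const

/-- One bus-edge closed constraint set is closed (private plumbing). [folklore] -/
private theorem isClosed_busConstraint (θs : Fin n → ℝ) (i : Fin n) (b : Fin m) :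
    IsClosed {θ : Fin n → ℝ | S.K i b ≠ 0 → |(θ i - S.β b) + (θs i - S.β b)| ≤ π} := by
  by_cases h : S.K i b = 0
  · have : {θ : Fin n → ℝ | S.K i b ≠ 0 → |(θ i - S.β b) + (θs i - S.β b)| ≤ π} = Set.univ := by
      ext θ
      simp [h]
    rw [this]
    exact isClosed_univ
  · have : {θ : Fin n → ℝ | S.K i b ≠ 0 → |(θ i - S.β b) + (θs i - S.β b)| ≤ π}
        = {θ | |(θ i - S.β b) + (θs i - S.β b)| ≤ π} := by
      ext θ
      simp [h]
    rw [this]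
    exact isClosed_le (by fun_prop) continuous_const

/-- The polytope is open. [cite: VuTuritsyn2016, §IV] -/
theorem isOpen_vtPolytope (θs : Fin n → ℝ) : IsOpen (S.vtPolytope θs) := by
  have h1 : IsOpen {θ : Fin n → ℝ | ∀ i j, S.C i j ≠ 0 → |(θ i - θ j) + (θs i - θs j)| < π} := by
    have heq : {θ : Fin n → ℝ | ∀ i j, S.C i j ≠ 0 → |(θ i - θ j) + (θs i - θs j)| < π}
        = ⋂ i, ⋂ j, {θ : Fin n → ℝ | S.C i j ≠ 0 → |(θ i - θ j) + (θs i - θs j)| < π} := by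
      ext θ
      simp only [Set.mem_setOf_eq, Set.mem_iInter]
    rw [heq]
    exact isOpen_iInter_of_finite fun i => isOpen_iInter_of_finite fun j =>
      S.isOpen_edgeConstraint θs i j
  have h2 : IsOpen {θ : Fin n → ℝ | ∀ i b, S.K i b ≠ 0 → |(θ i - S.β b) + (θs i - S.β b)| < π} := by
    have heq : {θ : Fin n → ℝ | ∀ i b, S.K i b ≠ 0 → |(θ i - S.β b) + (θs i - S.β b)| < π}
        = ⋂ i, ⋂ b, {θ : Fin n → ℝ | S.K i b ≠ 0 → |(θ i - S.β b) + (θs i - S.β b)| < π} := by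
      ext θ
      simp only [Set.mem_setOf_eq, Set.mem_iInter]
    rw [heq]
    exact isOpen_iInter_of_finite fun i => isOpen_iInter_of_finite fun b =>
      S.isOpen_busConstraint θs i b
  have heq : S.vtPolytope θs =
      {θ : Fin n → ℝ | ∀ i j, S.C i j ≠ 0 → |(θ i - θ j) + (θs i - θs j)| < π}
        ∩ {θ | ∀ i b, S.K i b ≠ 0 → |(θ i - S.β b) + (θs i - S.β b)| < π} := by
    ext θ
    simp [vtPolytope]
  rw [heq]
  exact h1.inter h2

/-- On the frontier of the polytope all edge constraints hold with `≤ π` and at least one machine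
edge or bus edge is tight (`= π`). [cite: VuTuritsyn2016, §IV (boundary segments ∂𝒫_kj)] -/
theorem exists_tight_of_mem_frontier_vtPolytope {θs θ : Fin n → ℝ}
    (hθ : θ ∈ frontier (S.vtPolytope θs)) :
    (∀ i j, S.C i j ≠ 0 → |(θ i - θ j) + (θs i - θs j)| ≤ π) ∧
      (∀ i b, S.K i b ≠ 0 → |(θ i - S.β b) + (θs i - S.β b)| ≤ π) ∧
      ((∃ i j, S.C i j ≠ 0 ∧ |(θ i - θ j) + (θs i - θs j)| = π) ∨
        (∃ i b, S.K i b ≠ 0 ∧ |(θ i - S.β b) + (θs i - S.β b)| = π)) := by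
  rw [frontier, (S.isOpen_vtPolytope θs).interior_eq] at hθ
  obtain ⟨hcl, hnot⟩ := hθ
  -- closure ⊆ the closed polytope
  set Pbar : Set (Fin n → ℝ) :=
    {θ | (∀ i j, S.C i j ≠ 0 → |(θ i - θ j) + (θs i - θs j)| ≤ π) ∧
      (∀ i b, S.K i b ≠ 0 → |(θ i - S.β b) + (θs i - S.β b)| ≤ π)} with hPbar
  have hclosed : IsClosed Pbar := by
    have h1 : IsClosed {θ : Fin n → ℝ | ∀ i j, S.C i j ≠ 0 →
        |(θ i - θ j) + (θs i - θs j)| ≤ π} := by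
      have heq : {θ : Fin n → ℝ | ∀ i j, S.C i j ≠ 0 → |(θ i - θ j) + (θs i - θs j)| ≤ π}
          = ⋂ i, ⋂ j, {θ : Fin n → ℝ | S.C i j ≠ 0 → |(θ i - θ j) + (θs i - θs j)| ≤ π} := by
        ext θ
        simp only [Set.mem_setOf_eq, Set.mem_iInter]
      rw [heq]
      exact isClosed_iInter fun i => isClosed_iInter fun j => S.isClosed_edgeConstraint θs i j
    have h2 : IsClosed {θ : Fin n → ℝ | ∀ i b, S.K i b ≠ 0 →
        |(θ i - S.β b) + (θs i - S.β b)| ≤ π} := by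
      have heq : {θ : Fin n → ℝ | ∀ i b, S.K i b ≠ 0 → |(θ i - S.β b) + (θs i - S.β b)| ≤ π}
          = ⋂ i, ⋂ b, {θ : Fin n → ℝ | S.K i b ≠ 0 → |(θ i - S.β b) + (θs i - S.β b)| ≤ π} := by
        ext θ
        simp only [Set.mem_setOf_eq, Set.mem_iInter]
      rw [heq]
      exact isClosed_iInter fun i => isClosed_iInter fun b => S.isClosed_busConstraint θs i b
    have heq : Pbar = {θ : Fin n → ℝ | ∀ i j, S.C i j ≠ 0 → |(θ i - θ j) + (θs i - θs j)| ≤ π}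
        ∩ {θ | ∀ i b, S.K i b ≠ 0 → |(θ i - S.β b) + (θs i - S.β b)| ≤ π} := by
      ext θ
      simp [hPbar]
    rw [heq]
    exact h1.inter h2
  have hsub : S.vtPolytope θs ⊆ Pbar := by
    rintro φ ⟨h1, h2⟩
    exact ⟨fun i j hij => (h1 i j hij).le, fun i b hib => (h2 i b hib).le⟩
  have hmem : θ ∈ Pbar := closure_minimal hsub hclosed hcl
  obtain ⟨hle1, hle2⟩ := hmem
  refine ⟨hle1, hle2, ?_⟩
  by_contra hcon
  apply hnot
  exact ⟨fun i j hij => lt_of_le_of_ne (hle1 i j hij) fun h => hcon (Or.inl ⟨i, j, hij, h⟩),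
    fun i b hib => lt_of_le_of_ne (hle2 i b hib) fun h => hcon (Or.inr ⟨i, b, hib, h⟩)⟩

/-- `sin` is minimal at `d` on `[d, π − d]` when `|d| ≤ π/2`. [folklore] -/
private theorem sin_le_sin_of_mem_Icc_right {d x : ℝ} (hd : |d| ≤ π / 2) (hx1 : d ≤ x)
    (hx2 : x ≤ π - d) : Real.sin d ≤ Real.sin x := by
  have hd1 : -(π / 2) ≤ d := by linarith [neg_abs_le d]
  rcases le_or_gt x (π / 2) with hx | hx
  · exact Real.sin_le_sin_of_le_of_le_pi_div_two hd1 hx hx1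
  · rw [← Real.sin_pi_sub x]
    exact Real.sin_le_sin_of_le_of_le_pi_div_two hd1 (by linarith) (by linarith)

/-- `sin` is maximal at `d` on `[−π − d, d]` when `|d| ≤ π/2`. [folklore] -/
private theorem sin_le_sin_of_mem_Icc_left {d x : ℝ} (hd : |d| ≤ π / 2) (hx1 : -π - d ≤ x)
    (hx2 : x ≤ d) : Real.sin x ≤ Real.sin d := by
  have hd2 : d ≤ π / 2 := by linarith [le_abs_self d]
  rcases le_or_gt (-(π / 2)) x with hx | hx
  · exact Real.sin_le_sin_of_le_of_le_pi_div_two hx hd2 hx2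
  · have hs : Real.sin x = Real.sin (-π - x) := by
      rw [show -π - x = -(x + π) by ring, Real.sin_neg, Real.sin_add_pi, neg_neg]
    rw [hs]
    exact Real.sin_le_sin_of_le_of_le_pi_div_two (by linarith) hd2 (by linarith)

/-- **`I_uv ≥ 0` on the polytope** (Vu–Turitsyn Appendix 9.3): for `|d| ≤ π/2` and
`|x + d| ≤ π`, `cos x + x sin d ≤ cos d + d sin d` — the edge function `−(cos δ + δ sin d)` is
smallest at `δ = d` on the whole range `|δ + d| ≤ π` (its derivative `sin δ − sin d` changes sign only
at `δ = d` there). [cite: VuTuritsyn2016, Appendix 9.3 («I_{uv} ≥ 0, ∀ x ∈ 𝒫»)] -/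
theorem cos_add_mul_sin_le {d x : ℝ} (hd : |d| ≤ π / 2) (hx : |x + d| ≤ π) :
    Real.cos x + x * Real.sin d ≤ Real.cos d + d * Real.sin d := by
  have hx1 : -π - d ≤ x := by linarith [neg_abs_le (x + d)]
  have hx2 : x ≤ π - d := by linarith [le_abs_self (x + d)]
  have hψd : ∀ y, HasDerivAt (fun y : ℝ => Real.cos y + y * Real.sin d)
      (-Real.sin y + Real.sin d) y := fun y => by
    have h2 : HasDerivAt (fun y : ℝ => y * Real.sin d) (Real.sin d) y := by
      simpa using (hasDerivAt_id y).mul_const (Real.sin d)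
    exact (Real.hasDerivAt_cos y).fun_add h2
  have hcont : Continuous (fun y : ℝ => Real.cos y + y * Real.sin d) := by fun_prop
  have hderiv : ∀ y, deriv (fun y : ℝ => Real.cos y + y * Real.sin d) y
      = -Real.sin y + Real.sin d := fun y => (hψd y).deriv
  have hdiff : Differentiable ℝ (fun y : ℝ => Real.cos y + y * Real.sin d) := fun y =>
    (hψd y).differentiableAt
  rcases le_total d x with hdx | hdx
  · -- the edge function is antitone on `[d, π − d]`
    have hanti : AntitoneOn (fun y : ℝ => Real.cos y + y * Real.sin d) (Icc d (π - d)) := by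
      refine antitoneOn_of_deriv_nonpos (convex_Icc _ _) hcont.continuousOn
        (hdiff.differentiableOn.mono interior_subset) fun y hy => ?_
      rw [interior_Icc] at hy
      rw [hderiv]
      linarith [sin_le_sin_of_mem_Icc_right hd hy.1.le hy.2.le]
    exact hanti ⟨le_rfl, by linarith [le_abs_self d]⟩ ⟨hdx, hx2⟩ hdx
  · -- the edge function is monotone on `[−π − d, d]`
    have hmono : MonotoneOn (fun y : ℝ => Real.cos y + y * Real.sin d) (Icc (-π - d) d) := by
      refine monotoneOn_of_deriv_nonneg (convex_Icc _ _) hcont.continuousOn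
        (hdiff.differentiableOn.mono interior_subset) fun y hy => ?_
      rw [interior_Icc] at hy
      rw [hderiv]
      linarith [sin_le_sin_of_mem_Icc_left hd hy.1.le hy.2.le]
    exact hmono ⟨hx1, hdx⟩ ⟨by linarith [neg_abs_le d], le_rfl⟩ hdx

/-- On the TIGHT face `|x + d| = π` the edge function has risen by at least the gap:
`vtGap d ≤ (cos d + d sin d) − (cos x + x sin d)` for `|d| ≤ π/2`. [cite: VuTuritsyn2016, Appendix 9.3] -/
theorem vtGap_le_of_abs_eq {d x : ℝ} (hd : |d| ≤ π / 2) (hx : |x + d| = π) :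
    vtGap d ≤ (Real.cos d + d * Real.sin d) - (Real.cos x + x * Real.sin d) := by
  have hd1 : -(π / 2) ≤ d := by linarith [neg_abs_le d]
  have hd2 : d ≤ π / 2 := by linarith [le_abs_self d]
  unfold vtGap
  rcases (abs_eq Real.pi_pos.le).1 hx with h | h
  · -- `x = π − d`
    have hx' : x = π - d := by linarith
    have hcos : Real.cos x = -Real.cos d := by rw [hx', Real.cos_pi_sub]
    rw [hcos, hx']
    rcases le_total 0 d with hd0 | hd0
    · rw [abs_of_nonneg hd0]
      nlinarith [Real.sin_nonneg_of_nonneg_of_le_pi hd0 (by linarith)]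
    · rw [abs_of_nonpos hd0, Real.sin_neg]
      have hs : Real.sin d ≤ 0 := Real.sin_nonpos_of_nonpos_of_neg_pi_le hd0 (by linarith)
      nlinarith [Real.pi_pos]
  · -- `x = −π − d`
    have hx' : x = -π - d := by linarith
    have hcos : Real.cos x = -Real.cos d := by
      rw [hx', show -π - d = -(d + π) by ring, Real.cos_neg, Real.cos_add_pi]
    rw [hcos, hx']
    rcases le_total 0 d with hd0 | hd0
    · rw [abs_of_nonneg hd0]
      have hs : 0 ≤ Real.sin d := Real.sin_nonneg_of_nonneg_of_le_pi hd0 (by linarith)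
      nlinarith [Real.pi_pos]
    · rw [abs_of_nonpos hd0, Real.sin_neg]
      nlinarith [Real.sin_nonpos_of_nonpos_of_neg_pi_le hd0 (by linarith)]

/-- Symmetrisation: for symmetric `C` and the antisymmetric kernel `sin(θˢ_i − θˢ_j)`,
`Σ_iΣ_j C_ij sin(θˢ_i − θˢ_j) θ_i = ½ Σ_iΣ_j C_ij (θ_i − θ_j) sin(θˢ_i − θˢ_j)` (private plumbing).
[folklore] -/
private theorem sum_sum_mul_sin_mul (hC : ∀ i j, S.C i j = S.C j i) (θs θ : Fin n → ℝ) :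
    ∑ i, ∑ j, S.C i j * Real.sin (θs i - θs j) * θ i
      = 1 / 2 * ∑ i, ∑ j, S.C i j * ((θ i - θ j) * Real.sin (θs i - θs j)) := by
  have hswap : ∑ i, ∑ j, S.C i j * Real.sin (θs i - θs j) * θ j
      = -∑ i, ∑ j, S.C i j * Real.sin (θs i - θs j) * θ i := by
    rw [Finset.sum_comm, ← Finset.sum_neg_distrib]
    refine Finset.sum_congr rfl fun i _ => ?_
    rw [← Finset.sum_neg_distrib]
    refine Finset.sum_congr rfl fun j _ => ?_
    rw [hC j i, show θs j - θs i = -(θs i - θs j) by ring, Real.sin_neg]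
    ring
  have hsplit : ∑ i, ∑ j, S.C i j * ((θ i - θ j) * Real.sin (θs i - θs j))
      = ∑ i, ∑ j, S.C i j * Real.sin (θs i - θs j) * θ i
        - ∑ i, ∑ j, S.C i j * Real.sin (θs i - θs j) * θ j := by
    rw [← Finset.sum_sub_distrib]
    refine Finset.sum_congr rfl fun i _ => ?_
    rw [← Finset.sum_sub_distrib]
    refine Finset.sum_congr rfl fun j _ => ?_
    ring
  rw [hsplit, hswap]
  ring

/-- THE ENERGY WRITTEN EDGE-WISE with the power balance at an equilibrium `θˢ` (the form
`−Σ K_kj(cos δ_kj + δ_kj sin δ*_kj)` of Vu–Turitsyn's (eq.Lyapunov) with `K_kj = B_kjV_kV_j`):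
`U(θ) = −½ΣᵢΣⱼ C_ij [cos θ_ij + θ_ij sin θˢ_ij] − ΣᵢΣ_b K_ib [cos(θ_i − β_b) + (θ_i − β_b) sin(θˢ_i − β_b)]
− ΣᵢΣ_b K_ib β_b sin(θˢ_i − β_b)` (the last sum is a constant). [cite: VuTuritsyn2016, §III eq. for V(x) («the classical Energy function is just one element … K = B_kj V_k V_j»)] -/
theorem potential_eq_edgeSum (hC : ∀ i j, S.C i j = S.C j i) {θs : Fin n → ℝ}
    (hes : S.IsEquilibrium θs) (θ : Fin n → ℝ) :
    S.potential θ =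
      -(1 / 2) * ∑ i, ∑ j, S.C i j * (Real.cos (θ i - θ j) + (θ i - θ j) * Real.sin (θs i - θs j))
        - ∑ i, ∑ b, S.K i b * (Real.cos (θ i - S.β b) + (θ i - S.β b) * Real.sin (θs i - S.β b))
        - ∑ i, ∑ b, S.K i b * S.β b * Real.sin (θs i - S.β b) := by
  have hP : ∑ i, S.P i * θ i
      = ∑ i, ∑ j, S.C i j * Real.sin (θs i - θs j) * θ i
        + ∑ i, ∑ b, S.K i b * Real.sin (θs i - S.β b) * θ i := by
    rw [← Finset.sum_add_distrib]
    refine Finset.sum_congr rfl fun i _ => ?_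
    rw [hes i, flow, add_mul, Finset.sum_mul, Finset.sum_mul]
  have h3 : ∑ i, ∑ b, S.K i b * Real.sin (θs i - S.β b) * θ i
      = ∑ i, ∑ b, S.K i b * ((θ i - S.β b) * Real.sin (θs i - S.β b))
        + ∑ i, ∑ b, S.K i b * S.β b * Real.sin (θs i - S.β b) := by
    rw [← Finset.sum_add_distrib]
    refine Finset.sum_congr rfl fun i _ => ?_
    rw [← Finset.sum_add_distrib]
    refine Finset.sum_congr rfl fun b _ => ?_
    ring
  have e1 : ∑ i, ∑ j, S.C i j * (Real.cos (θ i - θ j) + (θ i - θ j) * Real.sin (θs i - θs j))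
      = ∑ i, ∑ j, S.C i j * Real.cos (θ i - θ j)
        + ∑ i, ∑ j, S.C i j * ((θ i - θ j) * Real.sin (θs i - θs j)) := by
    rw [← Finset.sum_add_distrib]
    refine Finset.sum_congr rfl fun i _ => ?_
    rw [← Finset.sum_add_distrib]
    refine Finset.sum_congr rfl fun j _ => ?_
    ring
  have e2 : ∑ i, ∑ b, S.K i b * (Real.cos (θ i - S.β b) + (θ i - S.β b) * Real.sin (θs i - S.β b))
      = ∑ i, ∑ b, S.K i b * Real.cos (θ i - S.β b)
        + ∑ i, ∑ b, S.K i b * ((θ i - S.β b) * Real.sin (θs i - S.β b)) := by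
    rw [← Finset.sum_add_distrib]
    refine Finset.sum_congr rfl fun i _ => ?_
    rw [← Finset.sum_add_distrib]
    refine Finset.sum_congr rfl fun b _ => ?_
    ring
  unfold potential
  rw [hP, S.sum_sum_mul_sin_mul hC θs θ, h3, e1, e2]
  ring

/-- For non-negative `f` and `i ≠ j`, `f i j + f j i ≤ Σ_a Σ_b f a b` (private plumbing). [folklore] -/
private theorem add_le_sum_sum {f : Fin n → Fin n → ℝ} (hf : ∀ a b, 0 ≤ f a b) {i j : Fin n}
    (hij : i ≠ j) : f i j + f j i ≤ ∑ a, ∑ b, f a b := by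
  have h1 : f i j ≤ ∑ b, f i b :=
    Finset.single_le_sum (f := fun b => f i b) (fun b _ => hf i b) (Finset.mem_univ j)
  have h2 : f j i ≤ ∑ b, f j b :=
    Finset.single_le_sum (f := fun b => f j b) (fun b _ => hf j b) (Finset.mem_univ i)
  have h3 : ∑ a, ∑ b, f a b = ∑ b, f i b + ∑ a ∈ Finset.univ.erase i, ∑ b, f a b :=
    (Finset.add_sum_erase Finset.univ (fun a => ∑ b, f a b) (Finset.mem_univ i)).symm
  have h4 : ∑ b, f j b ≤ ∑ a ∈ Finset.univ.erase i, ∑ b, f a b :=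
    Finset.single_le_sum (f := fun a => ∑ b, f a b)
      (fun a _ => Finset.sum_nonneg fun b _ => hf a b)
      (Finset.mem_erase.2 ⟨hij.symm, Finset.mem_univ j⟩)
  linarith

/-- **Closed-form lower bound for `V_min` on the polytope** (Vu–Turitsyn §IV third construction,
Appendix 9.3, for the energy function): `C ≥ 0` symmetric, `K ≥ 0`, `θˢ` an equilibrium with
`|θˢ_i − θˢ_j| ≤ π/2` on machine edges and `|θˢ_i − β_b| ≤ π/2` on bus edges. If `c < U(θˢ) +
C_ij · vtGap(θˢ_i − θˢ_j)` for every machine edge and `c < U(θˢ) + K_ib · vtGap(θˢ_i − β_b)` for every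
bus edge, then `c < U(θ)` at every `θ` on the frontier of the polytope `𝒫(θˢ)`.
[cite: VuTuritsyn2016, §IV (third construction) and Appendix 9.3] -/
theorem lt_potential_of_mem_frontier_vtPolytope (hC : ∀ i j, S.C i j = S.C j i)
    (hCnn : ∀ i j, i ≠ j → 0 ≤ S.C i j) (hKnn : ∀ i b, 0 ≤ S.K i b) {θs : Fin n → ℝ}
    (hes : S.IsEquilibrium θs) (hcoh : ∀ i j, S.C i j ≠ 0 → |θs i - θs j| ≤ π / 2)
    (hcohb : ∀ i b, S.K i b ≠ 0 → |θs i - S.β b| ≤ π / 2) {c : ℝ}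
    (hcC : ∀ i j, i ≠ j → S.C i j ≠ 0 → c < S.potential θs + S.C i j * vtGap (θs i - θs j))
    (hcK : ∀ i b, S.K i b ≠ 0 → c < S.potential θs + S.K i b * vtGap (θs i - S.β b))
    {θ : Fin n → ℝ} (hθ : θ ∈ frontier (S.vtPolytope θs)) : c < S.potential θ := by
  obtain ⟨hle1, hle2, htight⟩ := S.exists_tight_of_mem_frontier_vtPolytope hθ
  -- edge terms: `T i j = C_ij (ψ(θs_ij) − ψ(θ_ij)) ≥ 0`, bus terms likewise
  set T : Fin n → Fin n → ℝ := fun i j => S.C i j *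
    ((Real.cos (θs i - θs j) + (θs i - θs j) * Real.sin (θs i - θs j))
      - (Real.cos (θ i - θ j) + (θ i - θ j) * Real.sin (θs i - θs j))) with hT
  set Tb : Fin n → Fin m → ℝ := fun i b => S.K i b *
    ((Real.cos (θs i - S.β b) + (θs i - S.β b) * Real.sin (θs i - S.β b))
      - (Real.cos (θ i - S.β b) + (θ i - S.β b) * Real.sin (θs i - S.β b))) with hTb
  have hTnn : ∀ i j, 0 ≤ T i j := by
    intro i j
    by_cases hij : i = j
    · subst hij
      simp [hT]
    by_cases h : S.C i j = 0
    · simp [hT, h]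
    · have h1 := cos_add_mul_sin_le (hcoh i j h) (hle1 i j h)
      exact mul_nonneg (hCnn i j hij) (by linarith)
  have hTbnn : ∀ i b, 0 ≤ Tb i b := by
    intro i b
    by_cases h : S.K i b = 0
    · simp [hTb, h]
    · have h1 := cos_add_mul_sin_le (hcohb i b h) (hle2 i b h)
      exact mul_nonneg (hKnn i b) (by linarith)
  -- `U θ − U θs = ½ ΣΣ T + ΣΣ Tb`
  have eT : ∑ i, ∑ j, T i j
      = ∑ i, ∑ j, S.C i j * (Real.cos (θs i - θs j) + (θs i - θs j) * Real.sin (θs i - θs j))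
        - ∑ i, ∑ j, S.C i j * (Real.cos (θ i - θ j) + (θ i - θ j) * Real.sin (θs i - θs j)) := by
    rw [← Finset.sum_sub_distrib]
    refine Finset.sum_congr rfl fun i _ => ?_
    rw [← Finset.sum_sub_distrib]
    refine Finset.sum_congr rfl fun j _ => ?_
    simp only [hT, mul_sub]
  have eTb : ∑ i, ∑ b, Tb i b
      = ∑ i, ∑ b, S.K i b * (Real.cos (θs i - S.β b) + (θs i - S.β b) * Real.sin (θs i - S.β b))
        - ∑ i, ∑ b, S.K i b *
            (Real.cos (θ i - S.β b) + (θ i - S.β b) * Real.sin (θs i - S.β b)) := by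
    rw [← Finset.sum_sub_distrib]
    refine Finset.sum_congr rfl fun i _ => ?_
    rw [← Finset.sum_sub_distrib]
    refine Finset.sum_congr rfl fun b _ => ?_
    simp only [hTb, mul_sub]
  have hdiff : S.potential θ - S.potential θs = 1 / 2 * ∑ i, ∑ j, T i j + ∑ i, ∑ b, Tb i b := by
    rw [eT, eTb, S.potential_eq_edgeSum hC hes θ, S.potential_eq_edgeSum hC hes θs]
    ring
  have hsumT : 0 ≤ ∑ i, ∑ j, T i j :=
    Finset.sum_nonneg fun i _ => Finset.sum_nonneg fun j _ => hTnn i j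
  have hsumTb : 0 ≤ ∑ i, ∑ b, Tb i b :=
    Finset.sum_nonneg fun i _ => Finset.sum_nonneg fun b _ => hTbnn i b
  rcases htight with ⟨i, j, hij, habs⟩ | ⟨i, b, hib, habs⟩
  · -- tight machine edge `(i, j)`: `T i j + T j i ≥ 2 C_ij vtGap`
    have hne : i ≠ j := by
      rintro rfl
      simp only [sub_self, add_zero, abs_zero] at habs
      exact Real.pi_pos.ne' habs.symm
    have hgap : S.C i j * vtGap (θs i - θs j) ≤ T i j :=
      mul_le_mul_of_nonneg_left (vtGap_le_of_abs_eq (hcoh i j hij) habs) (hCnn i j hne)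
    have habs' : |(θ j - θ i) + (θs j - θs i)| = π := by
      rw [show (θ j - θ i) + (θs j - θs i) = -((θ i - θ j) + (θs i - θs j)) by ring, abs_neg, habs]
    have hcoh' : |θs j - θs i| ≤ π / 2 := by
      rw [show θs j - θs i = -(θs i - θs j) by ring, abs_neg]
      exact hcoh i j hij
    have hgap' : S.C i j * vtGap (θs i - θs j) ≤ T j i := by
      have h : S.C j i * vtGap (θs j - θs i) ≤ T j i :=
        mul_le_mul_of_nonneg_left (vtGap_le_of_abs_eq hcoh' habs') (hCnn j i hne.symm)
      have hev : vtGap (θs j - θs i) = vtGap (θs i - θs j) := by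
        unfold vtGap
        rw [show θs j - θs i = -(θs i - θs j) by ring, abs_neg, Real.cos_neg]
      calc S.C i j * vtGap (θs i - θs j) = S.C j i * vtGap (θs j - θs i) := by rw [hC i j, hev]
        _ ≤ T j i := h
    have hpair : T i j + T j i ≤ ∑ a, ∑ b, T a b := add_le_sum_sum hTnn hne
    have := hcC i j hne hij
    linarith
  · -- tight bus edge `(i, b)`
    have hgap : S.K i b * vtGap (θs i - S.β b) ≤ Tb i b :=
      mul_le_mul_of_nonneg_left (vtGap_le_of_abs_eq (hcohb i b hib) habs) (hKnn i b)
    have hsingle : Tb i b ≤ ∑ a, ∑ b', Tb a b' := by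
      have h1 : Tb i b ≤ ∑ b', Tb i b' :=
        Finset.single_le_sum (f := fun b' => Tb i b') (fun b' _ => hTbnn i b') (Finset.mem_univ b)
      have h2 : ∑ b', Tb i b' ≤ ∑ a, ∑ b', Tb a b' :=
        Finset.single_le_sum (f := fun a => ∑ b', Tb a b')
          (fun a _ => Finset.sum_nonneg fun b' _ => hTbnn a b') (Finset.mem_univ i)
      linarith
    have := hcK i b hib
    linarith

/-- **The equilibrium is unique in Vu–Turitsyn's polytope** (the step «δ* is the only stationary
point inside 𝒫» of Appendix 9.2, with infinite buses): for `C` symmetric with off-diagonal entries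
`≥ 0`, `K ≥ 0`, a network connected through its buses (`CouplingConnectedToBus`, the cut condition
of `PhaseCohesiveEquilibriumUniqueness.lean`), and an equilibrium `θˢ` with `|θˢ_i − θˢ_j| < π/2` on
machine edges and `|θˢ_i − β_b| < π/2` on bus edges, every equilibrium `θ ∈ 𝒫(θˢ)` equals `θˢ`
(pairing identity `flow_pairing_eq_withInfiniteBuses` + strict sector bound
`sector_pos_of_abs_add_lt` on every edge + connectivity). [cite: VuTuritsyn2016, Appendix 9.2; DorflerChertkovBullo2013, SI §3.1 Lemma 2 (3)] -/
theorem eq_of_isEquilibrium_of_mem_vtPolytope (hC : ∀ i j, S.C i j = S.C j i)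
    (hCnn : ∀ i j, i ≠ j → 0 ≤ S.C i j) (hKnn : ∀ i b, 0 ≤ S.K i b)
    (hconn : CouplingConnectedToBus S.C S.K) {θs : Fin n → ℝ} (hes : S.IsEquilibrium θs)
    (hcoh : ∀ i j, S.C i j ≠ 0 → |θs i - θs j| < π / 2)
    (hcohb : ∀ i b, S.K i b ≠ 0 → |θs i - S.β b| < π / 2)
    {θ : Fin n → ℝ} (hθ : θ ∈ S.vtPolytope θs) (he : S.IsEquilibrium θ) : θ = θs := by
  obtain ⟨hP1, hP2⟩ := hθ
  set T : Fin n → Fin n → ℝ := fun i j => S.C i j * (((θ i - θ j) - (θs i - θs j))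
      * (Real.sin (θ i - θ j) - Real.sin (θs i - θs j))) with hT
  set U : Fin n → Fin m → ℝ := fun i b => S.K i b * (((θ i - S.β b) - (θs i - S.β b))
      * (Real.sin (θ i - S.β b) - Real.sin (θs i - S.β b))) with hU
  have hTnonneg : ∀ i j, 0 ≤ T i j := by
    intro i j
    by_cases hij : i = j
    · subst hij
      simp [hT]
    by_cases h0 : S.C i j = 0
    · simp [hT, h0]
    · exact mul_nonneg (hCnn i j hij)
        (SinusoidalCoupling.sector_nonneg (hcoh i j h0).le (hP1 i j h0).le)
  have hUnonneg : ∀ i b, 0 ≤ U i b := by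
    intro i b
    by_cases h0 : S.K i b = 0
    · simp [hU, h0]
    · exact mul_nonneg (hKnn i b)
        (SinusoidalCoupling.sector_nonneg (hcohb i b h0).le (hP2 i b h0).le)
  have htot : 1 / 2 * ∑ i, ∑ j, T i j + ∑ i, ∑ b, U i b = 0 := by
    have h := flow_pairing_eq_withInfiniteBuses S.C hC S.K S.β θs θ
    have h0 : ∑ i, (θ i - θs i) *
        ((∑ j, S.C i j * Real.sin (θ i - θ j) + ∑ b, S.K i b * Real.sin (θ i - S.β b))
          - (∑ j, S.C i j * Real.sin (θs i - θs j)
            + ∑ b, S.K i b * Real.sin (θs i - S.β b))) = 0 := by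
      refine Finset.sum_eq_zero fun i _ => ?_
      have h1 : ∑ j, S.C i j * Real.sin (θ i - θ j) + ∑ b, S.K i b * Real.sin (θ i - S.β b)
          = S.P i := (he i).symm
      have h2 : ∑ j, S.C i j * Real.sin (θs i - θs j) + ∑ b, S.K i b * Real.sin (θs i - S.β b)
          = S.P i := (hes i).symm
      rw [h1, h2, sub_self, mul_zero]
    rw [h0] at h
    simpa [hT, hU] using h.symm
  have hTsum : 0 ≤ ∑ i, ∑ j, T i j :=
    Finset.sum_nonneg fun i _ => Finset.sum_nonneg fun j _ => hTnonneg i j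
  have hUsum : 0 ≤ ∑ i, ∑ b, U i b :=
    Finset.sum_nonneg fun i _ => Finset.sum_nonneg fun b _ => hUnonneg i b
  have hT0 : ∑ i, ∑ j, T i j = 0 := by linarith
  have hU0 : ∑ i, ∑ b, U i b = 0 := by linarith
  have hTij : ∀ i j, T i j = 0 := by
    intro i j
    have hrow := (Finset.sum_eq_zero_iff_of_nonneg fun i _ =>
      Finset.sum_nonneg fun j _ => hTnonneg i j).mp hT0 i (Finset.mem_univ i)
    exact (Finset.sum_eq_zero_iff_of_nonneg fun j _ => hTnonneg i j).mp hrow j (Finset.mem_univ j)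
  have hUib : ∀ i b, U i b = 0 := by
    intro i b
    have hrow := (Finset.sum_eq_zero_iff_of_nonneg fun i _ =>
      Finset.sum_nonneg fun b _ => hUnonneg i b).mp hU0 i (Finset.mem_univ i)
    exact (Finset.sum_eq_zero_iff_of_nonneg fun b _ => hUnonneg i b).mp hrow b (Finset.mem_univ b)
  have hline : ∀ i j, i ≠ j → 0 < S.C i j → θ i - θ j = θs i - θs j := by
    intro i j _ hpos
    by_contra hne
    have h1 := SinusoidalCoupling.sector_pos_of_abs_add_lt (hcoh i j hpos.ne') (hP1 i j hpos.ne')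
      hne
    have : 0 < T i j := mul_pos hpos h1
    linarith [hTij i j]
  have hbus : ∀ i b, 0 < S.K i b → θ i = θs i := by
    intro i b hpos
    by_contra hne
    have hne' : θ i - S.β b ≠ θs i - S.β b := by
      intro h
      apply hne
      linarith
    have h1 := SinusoidalCoupling.sector_pos_of_abs_add_lt (hcohb i b hpos.ne') (hP2 i b hpos.ne')
      hne'
    have : 0 < U i b := mul_pos hpos h1
    linarith [hUib i b]
  exact eq_of_lineAngles_eq_withInfiniteBuses hconn hline hbus

/-- **Energy well ⊆ region of attraction, polytope form with the closed-form level** — the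
parametric `n`-machine, `m`-bus version of `SMIB.energyWell_subset_regionOfAttraction` and
`ChiangThreeMachine.energyWell_subset_regionOfAttraction`. Hypotheses: `M_i, D_i > 0`; `C`
symmetric with off-diagonal entries `≥ 0`, `K ≥ 0`, the network connected through its buses; `θˢ`
an equilibrium, strictly phase cohesive on the edges (`|θˢ_ij| < π/2`, `|θˢ_i − β_b| < π/2`); the
polytope `𝒫(θˢ)` bounded; and the level `c` below `U(θˢ) + w_e · vtGap(θˢ_e)` for every machine edge
and bus edge `e`. Conclusion: for every state `y = (θ, ω)` with `θ ∈ 𝒫(θˢ)`, `V(y) ≤ c`, a global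
solution from `y` exists and EVERY global solution from `y` keeps `θ(t) ∈ 𝒫(θˢ)`, `V ≤ c` for all
`t ≥ 0` and tends to `(θˢ, 0)`. CERTIFIED for the MODEL (lossless classical with buses of constant
angle) and CLASS = the well; no numerical input; inner estimate («ℛ … is an estimate of the
stability region»; conservative third construction of `V_min`).
[cite: VuTuritsyn2016, §IV (set ℛ, third construction), Appendices 9.2–9.3; SauerPai1998, §9.6.2 (9.48)] -/
theorem vtWell_subset_regionOfAttraction (hM : ∀ i, 0 < S.M i) (hD : ∀ i, 0 < S.D i)
    (hC : ∀ i j, S.C i j = S.C j i) (hCnn : ∀ i j, i ≠ j → 0 ≤ S.C i j) (hKnn : ∀ i b, 0 ≤ S.K i b)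
    (hconn : CouplingConnectedToBus S.C S.K) {θs : Fin n → ℝ} (hes : S.IsEquilibrium θs)
    (hcoh : ∀ i j, S.C i j ≠ 0 → |θs i - θs j| < π / 2)
    (hcohb : ∀ i b, S.K i b ≠ 0 → |θs i - S.β b| < π / 2)
    (hbdd : Bornology.IsBounded (S.vtPolytope θs)) {c : ℝ}
    (hcC : ∀ i j, i ≠ j → S.C i j ≠ 0 → c < S.potential θs + S.C i j * vtGap (θs i - θs j))
    (hcK : ∀ i b, S.K i b ≠ 0 → c < S.potential θs + S.K i b * vtGap (θs i - S.β b))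
    {y : (Fin n → ℝ) × (Fin n → ℝ)} (hy : y.1 ∈ S.vtPolytope θs) (hyc : S.energy y ≤ c) :
    (∃ X : ℝ → (Fin n → ℝ) × (Fin n → ℝ), X 0 = y ∧
        ∀ T : ℝ, ∀ t ∈ Icc 0 T, HasDerivWithinAt X (S.field (X t)) (Icc 0 T) t) ∧
      ∀ X : ℝ → (Fin n → ℝ) × (Fin n → ℝ), X 0 = y →
        (∀ T : ℝ, ∀ t ∈ Icc 0 T, HasDerivWithinAt X (S.field (X t)) (Icc 0 T) t) →
        (∀ t, 0 ≤ t → (X t).1 ∈ S.vtPolytope θs ∧ S.energy (X t) ≤ c) ∧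
          Tendsto X atTop (𝓝 (θs, 0)) :=
  S.energyWell_subset_regionOfAttraction hM hD hC (S.isOpen_vtPolytope θs) hbdd
    (fun _ hθ => S.lt_potential_of_mem_frontier_vtPolytope hC hCnn hKnn hes
      (fun i j h => (hcoh i j h).le) (fun i b h => (hcohb i b h).le) hcC hcK hθ)
    (fun _ hθ he _ => S.eq_of_isEquilibrium_of_mem_vtPolytope hC hCnn hKnn hconn hes hcoh hcohb
      hθ he) hy hyc


/-! ### Boundedness of the polytope from connectivity through the buses -/

/-- **The polytope is bounded on a network connected through its buses.** If every nonempty set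
of machines has a line (`C_ij > 0`) to a machine outside it or to a bus (`K_ib > 0`)
(`CouplingConnectedToBus`), then `𝒫(θˢ)` is bounded: growing the set of machines with a
certified bound one line at a time, every machine angle satisfies `|θ_i| < (n + 1) · L` with
`L = π + 2 Σ_k |θˢ_k| + 2 Σ_b |β_b|`. (With no bus the polytope contains the rotation orbit and is
unbounded.) [cite: VuTuritsyn2016, §IV (polytope 𝒫); DvijothamLowChertkov2015, §3.3 Cor. 1 (slack bus pinned)] -/
theorem isBounded_vtPolytope (hconn : CouplingConnectedToBus S.C S.K) (θs : Fin n → ℝ) :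
    Bornology.IsBounded (S.vtPolytope θs) := by
  classical
  set L : ℝ := π + 2 * ∑ k, |θs k| + 2 * ∑ b, |S.β b| with hL
  have hL0 : 0 ≤ L := by
    have h1 : 0 ≤ ∑ k, |θs k| := Finset.sum_nonneg fun k _ => abs_nonneg _
    have h2 : 0 ≤ ∑ b, |S.β b| := Finset.sum_nonneg fun b _ => abs_nonneg _
    have := Real.pi_pos.le
    simp only [hL]
    linarith
  have hθs : ∀ k, |θs k| ≤ ∑ k', |θs k'| := fun k =>
    Finset.single_le_sum (f := fun k' => |θs k'|) (fun k' _ => abs_nonneg _) (Finset.mem_univ k)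
  have hβ : ∀ b, |S.β b| ≤ ∑ b', |S.β b'| := fun b =>
    Finset.single_le_sum (f := fun b' => |S.β b'|) (fun b' _ => abs_nonneg _) (Finset.mem_univ b)
  -- the box `|θ_i| ≤ (n+1) L` is bounded; show the polytope lies inside
  have hbox : Bornology.IsBounded (Set.pi Set.univ fun _ : Fin n => Icc (-((n + 1) * L)) ((n + 1) * L)) :=
    (isCompact_univ_pi fun _ => isCompact_Icc).isBounded
  refine hbox.subset fun θ hθ => ?_
  obtain ⟨hP1, hP2⟩ := hθ
  -- one-line consequences of the constraints
  have hedge : ∀ i j, i ≠ j → 0 < S.C i j → |θ i| < L + |θ j| := by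
    intro i j hij hpos
    have h := hP1 i j hpos.ne'
    have h1 : |θ i - θ j| < π + |θs i - θs j| := by
      have := abs_add_le (θ i - θ j + (θs i - θs j)) (-(θs i - θs j))
      simp only [add_neg_cancel_right, abs_neg] at this
      linarith
    have h2 : |θs i - θs j| ≤ |θs i| + |θs j| := abs_sub _ _
    have h3 : |θ i| ≤ |θ i - θ j| + |θ j| := by
      have := abs_add_le (θ i - θ j) (θ j)
      simp only [sub_add_cancel] at this
      exact this
    have h4 : 0 ≤ ∑ b, |S.β b| := Finset.sum_nonneg fun b _ => abs_nonneg _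
    have := hθs i
    have := hθs j
    simp only [hL]
    linarith
  have hbusb : ∀ i b, 0 < S.K i b → |θ i| < L := by
    intro i b hpos
    have h := hP2 i b hpos.ne'
    have h1 : |θ i| ≤ |θ i - S.β b + (θs i - S.β b)| + |θs i - S.β b| + |S.β b| := by
      have e : θ i = (θ i - S.β b + (θs i - S.β b)) + (-(θs i - S.β b)) + S.β b := by ring
      have h := abs_add_three (θ i - S.β b + (θs i - S.β b)) (-(θs i - S.β b)) (S.β b)
      rw [abs_neg, ← e] at h
      exact h
    have h2 : |θs i - S.β b| ≤ |θs i| + |S.β b| := abs_sub _ _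
    have h3 : 0 ≤ ∑ k, |θs k| := Finset.sum_nonneg fun k _ => abs_nonneg _
    have := hθs i
    have := hβ b
    simp only [hL]
    linarith
  -- grow a set `R` of machines with `|θ_i| < (card R + 1) L`
  have hgrow : ∀ k, k ≤ n → ∃ R : Finset (Fin n), R.card = k ∧ ∀ i ∈ R, |θ i| < (k + 1) * L := by
    intro k
    induction k with
    | zero =>
      intro _
      exact ⟨∅, Finset.card_empty, fun i hi => absurd hi (Finset.notMem_empty i)⟩
    | succ k ih =>
      intro hk
      obtain ⟨R, hRcard, hR⟩ := ih (Nat.le_of_succ_le hk)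
      have hRne : R ≠ Finset.univ := by
        intro h
        rw [h, Finset.card_univ, Fintype.card_fin] at hRcard
        omega
      have hcne : Rᶜ.Nonempty := by
        rw [Finset.nonempty_iff_ne_empty, Ne, Finset.compl_eq_empty_iff]
        exact hRne
      obtain ⟨i, hiRc, hcase⟩ := hconn Rᶜ hcne
      have hiR : i ∉ R := Finset.mem_compl.1 hiRc
      have hbound : |θ i| < ((k : ℝ) + 1 + 1) * L := by
        rcases hcase with ⟨j, hj, hpos⟩ | ⟨b, hpos⟩
        · have hjR : j ∈ R := by simpa using hj
          have hij : i ≠ j := by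
            rintro rfl
            exact hiR hjR
          have h1 := hedge i j hij hpos
          have h2 := hR j hjR
          nlinarith
        · have h1 := hbusb i b hpos
          nlinarith
      refine ⟨insert i R, by rw [Finset.card_insert_of_notMem hiR, hRcard], fun i' hi' => ?_⟩
      rcases Finset.mem_insert.1 hi' with h | h
      · subst h
        push_cast
        exact hbound
      · have := hR i' h
        push_cast
        nlinarith
  obtain ⟨R, hRcard, hR⟩ := hgrow n le_rfl
  have hRuniv : R = Finset.univ :=
    Finset.eq_univ_of_card R (by rw [hRcard, Fintype.card_fin])
  intro i _
  have hi : |θ i| < (n + 1) * L := hR i (by rw [hRuniv]; exact Finset.mem_univ i)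
  exact ⟨by linarith [neg_abs_le (θ i)], by linarith [le_abs_self (θ i)]⟩

/-- **Energy well ⊆ region of attraction on Vu–Turitsyn's polytope, all hypotheses on the data.**
As `vtWell_subset_regionOfAttraction`, with the boundedness of `𝒫(θˢ)` discharged by
`isBounded_vtPolytope` (network connected through its buses): `M_i, D_i > 0`; `C` symmetric,
off-diagonal `≥ 0`; `K ≥ 0`; connected through the buses; `θˢ` a strictly phase-cohesive
equilibrium; `c < U(θˢ) + w_e · vtGap(θˢ_e)` for every edge `e` ⇒ the well `{θ ∈ 𝒫(θˢ), V ≤ c}` is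
positively invariant and every global solution from it tends to `(θˢ, 0)`. CERTIFIED for the MODEL
(lossless classical with buses of constant angle), CLASS = the well; inner estimate; no numerics.
[cite: VuTuritsyn2016, §IV (set ℛ, third construction), Appendices 9.2–9.3] -/
theorem vtWell_subset_regionOfAttraction' (hM : ∀ i, 0 < S.M i) (hD : ∀ i, 0 < S.D i)
    (hC : ∀ i j, S.C i j = S.C j i) (hCnn : ∀ i j, i ≠ j → 0 ≤ S.C i j) (hKnn : ∀ i b, 0 ≤ S.K i b)
    (hconn : CouplingConnectedToBus S.C S.K) {θs : Fin n → ℝ} (hes : S.IsEquilibrium θs)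
    (hcoh : ∀ i j, S.C i j ≠ 0 → |θs i - θs j| < π / 2)
    (hcohb : ∀ i b, S.K i b ≠ 0 → |θs i - S.β b| < π / 2) {c : ℝ}
    (hcC : ∀ i j, i ≠ j → S.C i j ≠ 0 → c < S.potential θs + S.C i j * vtGap (θs i - θs j))
    (hcK : ∀ i b, S.K i b ≠ 0 → c < S.potential θs + S.K i b * vtGap (θs i - S.β b))
    {y : (Fin n → ℝ) × (Fin n → ℝ)} (hy : y.1 ∈ S.vtPolytope θs) (hyc : S.energy y ≤ c) :
    (∃ X : ℝ → (Fin n → ℝ) × (Fin n → ℝ), X 0 = y ∧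
        ∀ T : ℝ, ∀ t ∈ Icc 0 T, HasDerivWithinAt X (S.field (X t)) (Icc 0 T) t) ∧
      ∀ X : ℝ → (Fin n → ℝ) × (Fin n → ℝ), X 0 = y →
        (∀ T : ℝ, ∀ t ∈ Icc 0 T, HasDerivWithinAt X (S.field (X t)) (Icc 0 T) t) →
        (∀ t, 0 ≤ t → (X t).1 ∈ S.vtPolytope θs ∧ S.energy (X t) ≤ c) ∧
          Tendsto X atTop (𝓝 (θs, 0)) :=
  S.vtWell_subset_regionOfAttraction hM hD hC hCnn hKnn hconn hes hcoh hcohb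
    (S.isBounded_vtPolytope hconn θs) hcC hcK hy hyc

end LosslessSystem

end Literature.MathematicalPhysics.PowerSystems.ClassicalModel
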